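import Summits.CriticalPhenomena.PercolationContinuityZ3.Theorems.PercNearOneGluingNoHeavyLowerTailSahiGridPatternTwoPayerFourVal

/-!
# `NoHeavyLowerTail` (crux stmt-CriticalPhenomena-4575), Sahi programme P1: **THE TWO-PAYER OR STAR ON THE FOUR-VALUED FAMILY, II —
# THREE ROUTES (U, A, D) THAT CLOSE CONDITION (N) IN EVERY DIMENSION, AND WHY NO TWO OF THEM SUFFICE**

Support file (Sahi cell, seat `prim-sahi-p1`, generation 38; `--supports stmt-CriticalPhenomena-4575`).  Pure proofs, no definitions, no `sorry`, standard axioms.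
Continuation of `…SahiGridPatternTwoPayerFourVal` (the slack identity `e(B∩C) − Θ_U(B×C) = 4·Σ₈ + 4·(d(P∩Q') + d(P'∩Q) − Θ_V(P×Q) − Θ_V(P'×Q'))`, `Σ₈ ≥ 0`,
for the two-payer OR star `U = (x∧y) ∨ V` tested against `B = (P | P')`, `C = (Q | Q')`).

THE MATHEMATICS (seat memo FROM-prim-sahi-p1-gen38-FOUR-VALUED-SURPLUS §2–§3).  Condition (N) of `U` on this family is the `d`-free inequality
`Σ₈ ≥ Θ_V(P×Q) + Θ_V(P'×Q') − Λ_V(S, P∩Q)`, `Λ_V(S,W) = min { y(S) + y(W) : y ∈ N(V) }` (`S = (P∩Q') ∪ (P'∩Q) ⊇ W = P∩Q`; an LP whose optimal packings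
change with the configuration).  Three packings give three all-`k` sufficient conditions, each using condition (N) of the certificate `d` of `V` twice:
* **`twoPayerFourVal_N_of_routeU`** — `N_V[P,Q'] + N_V[P',Q]`: (N) holds if the crossing mass `X = Θ_V((P'∖P)×(Q'∖Q)) ≤ Σ₈`;
* **`twoPayerFourVal_N_of_routeA`** — `N_V[⊤,S] + N_V[P,Q]`: (N) holds if `Θ_V(P'×Q') − Θ_V(⊤×S) ≤ Σ₈`;
* **`twoPayerFourVal_N_of_footprint`** — `N_V[P',Q'] + N_V[P,Q]` ("route D", `d ≥ 0`): (N) holds whenever `V ∩ P' ∩ Q' ⊆ P ∪ Q`, nothing to check;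
  **`twoPayerFourVal_N_cylinder`**: the cylinder pairs `B = [3]²×P`, `C = [3]²×Q`.
WHY THREE.  Exhaustively at `k = 2` one of U, A closes every configuration (gen36, 612 500 configurations); at `k = 3` U already fails with only one of `P', Q'`
full (gen37); at `k = 4` (this seat, pure-python exact engines `code/gen38/py/{srch38,verify4,fast4}.py`) the configuration
`P = ↑{0012,0202,1001}, P' = ↑{0001}, Q = ↑{0120}, Q' = ↑{0020}, V = ↑{0200,1001,1010,1100}` has `Σ₈ = 0`, `X = 8`, `Θ_V(P'×Q') − Θ_V(⊤×S) = 16`: routes U and A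
both FAIL, while `V∩P'∩Q' ⊆ P∪Q`, so route D closes it with equality — the two-route dichotomy "max(R_U, R_A) ≥ 0" conjectured in gen36/37 is FALSE from `k = 4` on,
and with `Q' = ↑{0010}` instead (`Σ₈ = 20`, needed `28`) U, A, D and the whole chain menu of gen37 fail while a constraint-generation LP over instances of
(N_V) AND (T_V) still closes the gap (kit j273120 of this seat; its dual solution uses (T_V) instances with positive weight — the first configuration found where
the `λ_V` upper bounds enter).  Nothing here asserts `PatternPos d` for `d ≥ 4` or condition (N) beyond the stated hypotheses. [this work]
-/

namespace Summit.CriticalPhenomena.PercolationContinuityZ3.Theorems.SahiGridPattern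

open Finset SahiGrid3
open scoped BigOperators

variable {k : ℕ}

section FourValRoutes

variable {V P P' Q Q' : Finset (Pd k)} {U B C : Finset (Pd (1 + (1 + k)))}

/-- **ROUTE U** (the crossed cover `N_V[P,Q'] + N_V[P',Q]`, every `k`): (N) holds on the four-valued family whenever the crossing mass
`X = Θ_V(P'×Q') + Θ_V(P×Q) − Θ_V(P×Q') − Θ_V(P'×Q)` (`= Θ_V((P'∖P)×(Q'∖Q))`) is at most the surplus `Σ₈`. [this work] -/
theorem twoPayerFourVal_N_of_routeU (hU : ∀ (ξ η : Pd 1) (q : Pd k), glue ξ (glue η q) ∈ U ↔ ((1 ≤ ξ 0 ∧ 1 ≤ η 0) ∨ q ∈ V))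
    (hB : ∀ (ξ η : Pd 1) (q : Pd k), glue ξ (glue η q) ∈ B ↔ ((ξ 0 = 0 ∧ q ∈ P) ∨ (1 ≤ ξ 0 ∧ q ∈ P')))
    (hC : ∀ (ξ η : Pd 1) (q : Pd k), glue ξ (glue η q) ∈ C ↔ ((η 0 = 0 ∧ q ∈ Q) ∨ (1 ≤ η 0 ∧ q ∈ Q')))
    (hP : IsUpperSet (P : Set (Pd k))) (hP' : IsUpperSet (P' : Set (Pd k))) (hQ : IsUpperSet (Q : Set (Pd k))) (hQ' : IsUpperSet (Q' : Set (Pd k)))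
    (d : Pd k → ℤ) (hdV : ∀ q, q ∉ V → d q = 0)
    (hN : ∀ A A' : Finset (Pd k), IsUpperSet (A : Set (Pd k)) → IsUpperSet (A' : Set (Pd k)) →
      (∑ q ∈ A, ∑ r ∈ A', thetaVal V q r) ≤ ∑ q ∈ A ∩ A', d q)
    (hX : (∑ q ∈ P', ∑ r ∈ Q', thetaVal V q r) + (∑ q ∈ P, ∑ r ∈ Q, thetaVal V q r)
        - (∑ q ∈ P, ∑ r ∈ Q', thetaVal V q r) - (∑ q ∈ P', ∑ r ∈ Q, thetaVal V q r)
        ≤ (∑ q : Pd k, ∑ r : Pd k, (if TotDist q r = true then (1:ℤ) else 0) *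
      ( ind P' r * (ind Q' r - ind Q' (thirdPt q r)) + 2 * (ind P' r * (ind Q r * ind V r - ind Q (thirdPt q r) * ind V (thirdPt q r))) + ind P' r * (ind Q' r * ind V r - ind Q' (thirdPt q r) * ind V (thirdPt q r)) + 2 * (ind Q' r * (ind P r * ind V r - ind P (thirdPt q r) * ind V (thirdPt q r))) + ind Q' r * (ind P' r * ind V r - ind P' (thirdPt q r) * ind V (thirdPt q r)) + 3 * ((1 - ind V q) * (ind P' r * (ind Q' r - ind Q' (thirdPt q r)))) + (ind P' q - ind P q) * (ind Q' q - ind Q q) * ind V q + (ind P' q - ind P q) * (ind Q' r - ind Q r) * (1 - ind V (thirdPt q r)) ))) :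
    (∑ x ∈ B, ∑ y ∈ C, thetaVal U x y) ≤ ∑ x ∈ B ∩ C, (fun x : Pd (1 + (1 + k)) =>
        if (1 ≤ freeOf x 0 ∧ 1 ≤ freeOf (cellOf x) 0) then (4 * 2 ^ k + 3 * (2 ^ k * ind V (cellOf (cellOf x)) - (nuCount V (cellOf (cellOf x)) : ℤ)))
        else if (freeOf x 0 = 0 ∧ freeOf (cellOf x) 0 = 0) then 4 * 2 ^ k * ind V (cellOf (cellOf x))
        else (2 * 2 ^ k + 2 * d (cellOf (cellOf x))) * ind V (cellOf (cellOf x))) x := by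
  have h := twoPayerFourVal_slack_eq hU hB hC d hdV
  have n1 := hN P Q' hP hQ'
  have n2 := hN P' Q hP' hQ
  linarith

/-- **ROUTE A** (the top cover `N_V[⊤,S] + N_V[P,Q]`, `S = (P∩Q') ∪ (P'∩Q)`, every `k`): (N) holds on the four-valued family whenever
`Θ_V(P'×Q') − Θ_V(⊤×S) ≤ Σ₈` (`Θ_V(⊤×S) = 2^k·#(V∩S)`). [this work] -/
theorem twoPayerFourVal_N_of_routeA (hU : ∀ (ξ η : Pd 1) (q : Pd k), glue ξ (glue η q) ∈ U ↔ ((1 ≤ ξ 0 ∧ 1 ≤ η 0) ∨ q ∈ V))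
    (hB : ∀ (ξ η : Pd 1) (q : Pd k), glue ξ (glue η q) ∈ B ↔ ((ξ 0 = 0 ∧ q ∈ P) ∨ (1 ≤ ξ 0 ∧ q ∈ P')))
    (hC : ∀ (ξ η : Pd 1) (q : Pd k), glue ξ (glue η q) ∈ C ↔ ((η 0 = 0 ∧ q ∈ Q) ∨ (1 ≤ η 0 ∧ q ∈ Q')))
    (hP : IsUpperSet (P : Set (Pd k))) (hP' : IsUpperSet (P' : Set (Pd k))) (hQ : IsUpperSet (Q : Set (Pd k))) (hQ' : IsUpperSet (Q' : Set (Pd k)))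
    (hPP' : P ⊆ P') (hQQ' : Q ⊆ Q')
    (d : Pd k → ℤ) (hdV : ∀ q, q ∉ V → d q = 0)
    (hN : ∀ A A' : Finset (Pd k), IsUpperSet (A : Set (Pd k)) → IsUpperSet (A' : Set (Pd k)) →
      (∑ q ∈ A, ∑ r ∈ A', thetaVal V q r) ≤ ∑ q ∈ A ∩ A', d q)
    (hA : (∑ q ∈ P', ∑ r ∈ Q', thetaVal V q r) - (∑ q ∈ (univ : Finset (Pd k)), ∑ r ∈ (P ∩ Q') ∪ (P' ∩ Q), thetaVal V q r)
        ≤ (∑ q : Pd k, ∑ r : Pd k, (if TotDist q r = true then (1:ℤ) else 0) *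
      ( ind P' r * (ind Q' r - ind Q' (thirdPt q r)) + 2 * (ind P' r * (ind Q r * ind V r - ind Q (thirdPt q r) * ind V (thirdPt q r))) + ind P' r * (ind Q' r * ind V r - ind Q' (thirdPt q r) * ind V (thirdPt q r)) + 2 * (ind Q' r * (ind P r * ind V r - ind P (thirdPt q r) * ind V (thirdPt q r))) + ind Q' r * (ind P' r * ind V r - ind P' (thirdPt q r) * ind V (thirdPt q r)) + 3 * ((1 - ind V q) * (ind P' r * (ind Q' r - ind Q' (thirdPt q r)))) + (ind P' q - ind P q) * (ind Q' q - ind Q q) * ind V q + (ind P' q - ind P q) * (ind Q' r - ind Q r) * (1 - ind V (thirdPt q r)) ))) :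
    (∑ x ∈ B, ∑ y ∈ C, thetaVal U x y) ≤ ∑ x ∈ B ∩ C, (fun x : Pd (1 + (1 + k)) =>
        if (1 ≤ freeOf x 0 ∧ 1 ≤ freeOf (cellOf x) 0) then (4 * 2 ^ k + 3 * (2 ^ k * ind V (cellOf (cellOf x)) - (nuCount V (cellOf (cellOf x)) : ℤ)))
        else if (freeOf x 0 = 0 ∧ freeOf (cellOf x) 0 = 0) then 4 * 2 ^ k * ind V (cellOf (cellOf x))
        else (2 * 2 ^ k + 2 * d (cellOf (cellOf x))) * ind V (cellOf (cellOf x))) x := by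
  have h := twoPayerFourVal_slack_eq hU hB hC d hdV
  have huniv : IsUpperSet ((univ : Finset (Pd k)) : Set (Pd k)) := by rw [Finset.coe_univ]; exact isUpperSet_univ
  have hS : IsUpperSet ((((P ∩ Q') ∪ (P' ∩ Q)) : Finset (Pd k)) : Set (Pd k)) := by
    rw [Finset.coe_union]; exact (isUpperSet_inter_coe hP hQ').union (isUpperSet_inter_coe hP' hQ)
  have n1 := hN univ ((P ∩ Q') ∪ (P' ∩ Q)) huniv hS
  have n2 := hN P Q hP hQ
  rw [Finset.univ_inter] at n1
  have e : (∑ q ∈ (P ∩ Q') ∪ (P' ∩ Q), d q) + (∑ q ∈ P ∩ Q, d q) = (∑ q ∈ P ∩ Q', d q) + (∑ q ∈ P' ∩ Q, d q) := by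
    have hi : (P ∩ Q') ∩ (P' ∩ Q) = P ∩ Q := by
      ext x; simp only [Finset.mem_inter]
      exact ⟨fun h => ⟨h.1.1, h.2.2⟩, fun h => ⟨⟨h.1, hQQ' h.2⟩, ⟨hPP' h.1, h.2⟩⟩⟩
    rw [← hi, Finset.sum_union_inter]
  linarith

/-- **ROUTE D — the footprint condition** (cover `N_V[P',Q'] + N_V[P,Q]`, every `k`, `d ≥ 0`): if `V ∩ P' ∩ Q' ⊆ P ∪ Q` then (N) holds on the four-valued
family with nothing else to check (`d(P∩Q') + d(P'∩Q) = d(S) + d(P∩Q) ≥ d(P'∩Q') + d(P∩Q) ≥ Θ_V(P'×Q') + Θ_V(P×Q)`).  This is the route that closes the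
`k = 4` configuration of the file header on which routes U and A both fail. [this work] -/
theorem twoPayerFourVal_N_of_footprint (hU : ∀ (ξ η : Pd 1) (q : Pd k), glue ξ (glue η q) ∈ U ↔ ((1 ≤ ξ 0 ∧ 1 ≤ η 0) ∨ q ∈ V))
    (hB : ∀ (ξ η : Pd 1) (q : Pd k), glue ξ (glue η q) ∈ B ↔ ((ξ 0 = 0 ∧ q ∈ P) ∨ (1 ≤ ξ 0 ∧ q ∈ P')))
    (hC : ∀ (ξ η : Pd 1) (q : Pd k), glue ξ (glue η q) ∈ C ↔ ((η 0 = 0 ∧ q ∈ Q) ∨ (1 ≤ η 0 ∧ q ∈ Q')))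
    (hP : IsUpperSet (P : Set (Pd k))) (hP' : IsUpperSet (P' : Set (Pd k))) (hQ : IsUpperSet (Q : Set (Pd k))) (hQ' : IsUpperSet (Q' : Set (Pd k)))
    (hV : IsUpperSet (V : Set (Pd k))) (hPP' : P ⊆ P') (hQQ' : Q ⊆ Q')
    (d : Pd k → ℤ) (hd0 : ∀ q, 0 ≤ d q) (hdV : ∀ q, q ∉ V → d q = 0)
    (hN : ∀ A A' : Finset (Pd k), IsUpperSet (A : Set (Pd k)) → IsUpperSet (A' : Set (Pd k)) →
      (∑ q ∈ A, ∑ r ∈ A', thetaVal V q r) ≤ ∑ q ∈ A ∩ A', d q)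
    (hR : V ∩ P' ∩ Q' ⊆ P ∪ Q) :
    (∑ x ∈ B, ∑ y ∈ C, thetaVal U x y) ≤ ∑ x ∈ B ∩ C, (fun x : Pd (1 + (1 + k)) =>
        if (1 ≤ freeOf x 0 ∧ 1 ≤ freeOf (cellOf x) 0) then (4 * 2 ^ k + 3 * (2 ^ k * ind V (cellOf (cellOf x)) - (nuCount V (cellOf (cellOf x)) : ℤ)))
        else if (freeOf x 0 = 0 ∧ freeOf (cellOf x) 0 = 0) then 4 * 2 ^ k * ind V (cellOf (cellOf x))
        else (2 * 2 ^ k + 2 * d (cellOf (cellOf x))) * ind V (cellOf (cellOf x))) x := by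
  refine twoPayerFourVal_N_of_D hU hB hC hP hP' hQ hQ' hV hPP' hQQ' d hdV ?_
  have n1 := hN P' Q' hP' hQ'
  have n2 := hN P Q hP hQ
  -- d(P∩Q') + d(P'∩Q) = d(S) + d(P∩Q) and d(S) ≥ d(P'∩Q') since supp d ∩ P' ∩ Q' ⊆ S and d ≥ 0
  have hi : (P ∩ Q') ∩ (P' ∩ Q) = P ∩ Q := by
    ext x; simp only [Finset.mem_inter]
    exact ⟨fun h => ⟨h.1.1, h.2.2⟩, fun h => ⟨⟨h.1, hQQ' h.2⟩, ⟨hPP' h.1, h.2⟩⟩⟩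
  have e : (∑ q ∈ (P ∩ Q') ∪ (P' ∩ Q), d q) + (∑ q ∈ P ∩ Q, d q) = (∑ q ∈ P ∩ Q', d q) + (∑ q ∈ P' ∩ Q, d q) := by
    rw [← hi, Finset.sum_union_inter]
  have hsub : (P' ∩ Q').filter (fun q => q ∈ V) ⊆ (P ∩ Q') ∪ (P' ∩ Q) := by
    intro x hx
    rw [Finset.mem_filter, Finset.mem_inter] at hx
    have hxR : x ∈ P ∪ Q := hR (Finset.mem_inter.2 ⟨Finset.mem_inter.2 ⟨hx.2, hx.1.1⟩, hx.1.2⟩)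
    rcases Finset.mem_union.1 hxR with h | h
    · exact Finset.mem_union.2 (Or.inl (Finset.mem_inter.2 ⟨h, hx.1.2⟩))
    · exact Finset.mem_union.2 (Or.inr (Finset.mem_inter.2 ⟨hx.1.1, h⟩))
  have hfil : (∑ q ∈ P' ∩ Q', d q) = ∑ q ∈ (P' ∩ Q').filter (fun q => q ∈ V), d q := by
    rw [Finset.sum_filter]
    refine Finset.sum_congr rfl fun q _ => ?_
    by_cases hq : q ∈ V
    · rw [if_pos hq]
    · rw [if_neg hq, hdV q hq]
  have hle : (∑ q ∈ (P' ∩ Q').filter (fun q => q ∈ V), d q) ≤ ∑ q ∈ (P ∩ Q') ∪ (P' ∩ Q), d q :=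
    Finset.sum_le_sum_of_subset_of_nonneg hsub (fun q _ _ => hd0 q)
  linarith

/-- **Cylinder pairs** (`P = P'`, `Q = Q'`: `B = [3]²×P`, `C = [3]²×Q`): (N) for the two-payer star holds with no inequality to check — the footprint condition
is automatic. [this work] -/
theorem twoPayerFourVal_N_cylinder {V P Q : Finset (Pd k)} {U B C : Finset (Pd (1 + (1 + k)))}
    (hU : ∀ (ξ η : Pd 1) (q : Pd k), glue ξ (glue η q) ∈ U ↔ ((1 ≤ ξ 0 ∧ 1 ≤ η 0) ∨ q ∈ V))
    (hB : ∀ (ξ η : Pd 1) (q : Pd k), glue ξ (glue η q) ∈ B ↔ q ∈ P) (hC : ∀ (ξ η : Pd 1) (q : Pd k), glue ξ (glue η q) ∈ C ↔ q ∈ Q)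
    (hP : IsUpperSet (P : Set (Pd k))) (hQ : IsUpperSet (Q : Set (Pd k))) (hV : IsUpperSet (V : Set (Pd k)))
    (d : Pd k → ℤ) (hd0 : ∀ q, 0 ≤ d q) (hdV : ∀ q, q ∉ V → d q = 0)
    (hN : ∀ A A' : Finset (Pd k), IsUpperSet (A : Set (Pd k)) → IsUpperSet (A' : Set (Pd k)) →
      (∑ q ∈ A, ∑ r ∈ A', thetaVal V q r) ≤ ∑ q ∈ A ∩ A', d q) :
    (∑ x ∈ B, ∑ y ∈ C, thetaVal U x y) ≤ ∑ x ∈ B ∩ C, (fun x : Pd (1 + (1 + k)) =>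
        if (1 ≤ freeOf x 0 ∧ 1 ≤ freeOf (cellOf x) 0) then (4 * 2 ^ k + 3 * (2 ^ k * ind V (cellOf (cellOf x)) - (nuCount V (cellOf (cellOf x)) : ℤ)))
        else if (freeOf x 0 = 0 ∧ freeOf (cellOf x) 0 = 0) then 4 * 2 ^ k * ind V (cellOf (cellOf x))
        else (2 * 2 ^ k + 2 * d (cellOf (cellOf x))) * ind V (cellOf (cellOf x))) x := by
  have tri : ∀ ξ : Pd 1, ξ 0 = 0 ∨ 1 ≤ ξ 0 := fun ξ => by
    rcases Nat.eq_zero_or_pos (ξ 0 : ℕ) with h | h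
    · exact Or.inl (Fin.ext h)
    · exact Or.inr (by
        show (1:Fin 3) ≤ ξ 0
        rw [Fin.le_def]; exact h)
  have hB' : ∀ (ξ η : Pd 1) (q : Pd k), glue ξ (glue η q) ∈ B ↔ ((ξ 0 = 0 ∧ q ∈ P) ∨ (1 ≤ ξ 0 ∧ q ∈ P)) := fun ξ η q => by
    rw [hB]; constructor
    · intro h; rcases tri ξ with h0 | h1
      · exact Or.inl ⟨h0, h⟩
      · exact Or.inr ⟨h1, h⟩
    · rintro (⟨_, h⟩ | ⟨_, h⟩) <;> exact h
  have hC' : ∀ (ξ η : Pd 1) (q : Pd k), glue ξ (glue η q) ∈ C ↔ ((η 0 = 0 ∧ q ∈ Q) ∨ (1 ≤ η 0 ∧ q ∈ Q)) := fun ξ η q => by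
    rw [hC]; constructor
    · intro h; rcases tri η with h0 | h1
      · exact Or.inl ⟨h0, h⟩
      · exact Or.inr ⟨h1, h⟩
    · rintro (⟨_, h⟩ | ⟨_, h⟩) <;> exact h
  refine twoPayerFourVal_N_of_footprint hU hB' hC' hP hP hQ hQ hV (subset_refl P) (subset_refl Q) d hd0 hdV hN ?_
  intro x hx
  rw [Finset.mem_inter, Finset.mem_inter] at hx
  exact Finset.mem_union.2 (Or.inl hx.1.2)

end FourValRoutes

end Summit.CriticalPhenomena.PercolationContinuityZ3.Theorems.SahiGridPattern
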